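import Summits.QuantumFields.BalabanUV.Beta.GAN24.LambdaPieceThreeFace
import Summits.QuantumFields.BalabanUV.Beta.GAN24.SymHessianGaugeLegContact
import Summits.QuantumFields.BalabanUV.Beta.GAN24.SymLinKernelFaceSupport

/-!
# `BalabanUV.Beta.GAN24.SymLambdaPieceThreeFace` — binder row G-an2-4 ∕ (CONV-C), TRANSFER-III, the (III′) (C)-campaign's supplier `hB0` AT LEVELS `≥ 1`, the comb «3F-REC» chain's
# Λ-LETTER: **(T-H)_face FOR an1's SYMMETRISED CONSTRAINT HESSIAN `symHessFFAt ρ_c Lc`** (the record field `(symTablesAn1S2 d Lc cΛt).H`, centred root, `Lc` odd) — the decl-by-decl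
# twin of leaf-04 g62's `LambdaPieceThreeFace` (there: an1's rooted `hessFFAt ρ`): for ANY coefficient family `c` with the Λ-piece `SLam Lc c symHessFFAt` local, every period `Lc^{k+1}` and
# all `(γ, α, β)`, the three-face-legs cell form of the Λ-piece VANISHES; instances `lamCoeffK (KInvStep Lc (j+1)) (E2 (j+1))` (every level) and `lamCoeffOf (KInv Lc)` (level `0`).
# (G-an2-4 CRUX TEAM (2), leaf prover `b2b-balaban-gan24-formalise-leaf-01`, gen 87; README-g87 §ROADMAP step 2)

HOW ([folklore]).  leaf-02 g47's sym `dψ`-law `SymHessianGaugeLegContact.tsum_dz_mul_SLam_symHessFFAt` (kernel `symLinKerAt` in place of `linKerAt`) with `ψ = ⌊·_α ∕ Lc^{k+1}⌋` (whose gradient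
is the period-`Lc^{k+1}` exit-face form, `LambdaPieceThreeFace.dz_coarseCoord`), and the pointwise support lemma §1: on a period-`Lc^{k+1}` exit-face bond the four coarse coordinates pair
off — leaf-02 g55's `SymLinKernelFaceSupport.exitFace_support_mu` (the straight bond: `x_μ = Lc·y_μ + Lc − 1`, transverse coordinates in the block range) and
`symLinKerAt_eq_zero_of_exitFace_of_ne` (a transverse exit-face bond carries no sym first-order kernel), `Lc` odd, centred root.

NOT IN PRINT; OUR BOOKKEEPING ([folklore] BY NAME; 0 `def`, 0 cited fact, 0 `def … : Prop`, 0 sorry).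
HONEST FRAMING (cell contract, verbatim): «discharging `BetaPertH` makes Bałaban's UV stability UNCONDITIONAL — a real constructive-QFT result; it is NOT the continuum limit and NOT
the Clay problem.»  HONEST DEPENDENCY (verbatim): «continuum YM on T⁴ ⇐ BetaPertH ∧ nine spine estimates (0/9 proved); BetaPertH ⇐ (D1) ∧ (D4) ∧ CAP+tail; G-an2-4 gates asym, D1
and NE2/3/4.»

## What is proved (generic `d`, `Lc` odd, centred root `ctr (d+1) Lc`)
* §1 **`face_coordW_symLinKerAt_eq_zero`** (the key support lemma, every period `Lc^{k+1}`).
* §2 `tsum_face_mul_SLam_symHessFFAt`, `face_mul_tsum_face_mul_SLam_symHessFFAt`, **`tsum_faces_SLam_symHessFFAt_eq_zero`**, **`threeFace_SLam_symHessFFAt_eq_zero`**.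
* §3 the instances **`threeFace_SLam_lamCoeffK_sym_eq_zero`** (every level `j`), **`threeFace_SLam_lamCoeffOf_sym_eq_zero`** (level `0`).
WHAT THIS IS NOT: NOT «3F-REC» at the comb (the recursion's assembly is the next file); NOT (Z)_comb; NOT `hB0`; NEVER «G-an2-4 closed» as (CONV-C); NOT D1, NOT `BetaPertH`, NOT continuum,
NOT Clay.  2026-08-27; no existing file touched.
-/

noncomputable section

open Finset
open scoped BigOperators
open Literature.MathematicalPhysics.QuantumFieldTheory
open Literature.MathematicalPhysics.QuantumFieldTheory.Balaban1983to89
open Literature.MathematicalPhysics.QuantumFieldTheory.Balaban1983to89.Beta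
open B12Sec2to5 (l1)
open ExpKernelCalculus (Site MKer BiLoc Decays VertexFamily Zl Zl_nonneg)
open AffineAveraging (Form0 Form1 box toSite unitVec unitVec_apply dz)
open AveragingContours (blk)
open AveragingContoursRooted (ctr ctrOff ctr_apply ctrOff_mem_box two_mul_half_add_one)
open AveragingHessianKernels (Bond ell)
open OneStepResolventKernel (Fib KInv LocStencil decays_KInv decays_mono)
open OneStepKernelFamily (KInvStep decays_KInvStep)
open BalabanStepJets (lamCoeffOf abs_lamCoeffOf_le)
open BalabanStepJetsSucc (E2 decays_E2 lamCoeffK abs_lamCoeffK_le)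
open InterLevelTransport (SLam locStencil_SLam)
open Summit.QuantumFields.BalabanUV.Beta.SymAveragingHessianCounts (symLinKerAt symHessFFAt vertexFamily_symHessFFAt)
open Summit.QuantumFields.BalabanUV.Beta.GAN24.LambdaPieceThreeFace (ediv_pow_succ_eq_blk dz_coarseCoord summable_weighted_pairs)
open Summit.QuantumFields.BalabanUV.Beta.GAN24.FaceWeightedSandwich (emod_mul_eq_iff)
open Summit.QuantumFields.BalabanUV.Beta.GAN24.SymHessianGaugeLegContact (tsum_dz_mul_SLam_symHessFFAt)
open Summit.QuantumFields.BalabanUV.Beta.GAN24.SymLinKernelFaceSupport (exitFace_support_mu symLinKerAt_eq_zero_of_exitFace_of_ne)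
open Summit.QuantumFields.BalabanUV.Beta.GAN24.SymLinKernelBlockMoments (ediv_eq_of_mem_range)

namespace Summit.QuantumFields.BalabanUV.Beta.GAN24.SymLambdaPieceThreeFace

variable {d : ℕ} {Lc : ℕ}

/-! ## §1 The key support lemma at the centred root, `Lc` odd -/

/-- NOT IN PRINT; OUR BOOKKEEPING ([folklore]).  **ON A PERIOD-`Lc^{k+1}` EXIT-FACE BOND THE FOUR COARSE COORDINATES PAIR OFF AGAINST an1's SYMMETRISED FIRST-ORDER KERNEL**:
for `Lc` odd, the centred root `ρ_c = ctr (d+1) Lc`, every coarse bond `(μ, y)`, fine bond `(β, x′)` and direction `α`,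
`[x′_β % Lc^{k+1} = Lc^{k+1} − 1] · (ψ x′ + ψ (x′ + e_β) − ψ r_{(μ,y)} − ψ (r_{(μ,y)} + Lc•e_μ)) · q¹_sym(β, x′) = 0`, `ψ z = ⌊z_α ∕ Lc^{k+1}⌋`, `r_{(μ,y)} = Lc•y + ρ_c`. -/
theorem face_coordW_symLinKerAt_eq_zero (hLo : Odd Lc) (k : ℕ) (μ : Fin (d + 1)) (y : Site (d + 1)) (α β : Fin (d + 1)) (x' : Site (d + 1)) :
    (if x' β % ((Lc ^ (k + 1) : ℕ) : ℤ) = ((Lc ^ (k + 1) : ℕ) : ℤ) - 1 then (1 : ℝ) else 0) *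
      (((((x') α / ((Lc ^ (k + 1) : ℕ) : ℤ) : ℤ) : ℝ) + (((x' + unitVec β) α / ((Lc ^ (k + 1) : ℕ) : ℤ) : ℤ) : ℝ)
          - ((((Lc : ℤ) • y + ctr (d + 1) Lc) α / ((Lc ^ (k + 1) : ℕ) : ℤ) : ℤ) : ℝ) - ((((Lc : ℤ) • y + ctr (d + 1) Lc + (Lc : ℤ) • unitVec μ) α / ((Lc ^ (k + 1) : ℕ) : ℤ) : ℤ) : ℝ))
        * symLinKerAt (ctr (d + 1) Lc) Lc μ y (β, x')) = 0 := by
  have hLc : 1 ≤ Lc := by obtain ⟨m, rfl⟩ := hLo; omega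
  by_cases hF : x' β % ((Lc ^ (k + 1) : ℕ) : ℤ) = ((Lc ^ (k + 1) : ℕ) : ℤ) - 1
  swap
  · rw [if_neg hF, zero_mul]
  rw [if_pos hF, one_mul]
  by_cases hq : symLinKerAt (ctr (d + 1) Lc) Lc μ y (β, x') = 0
  · rw [hq, mul_zero]
  -- on the support: the bond crosses an `Lc`-face in direction `β`
  have hLc0 : (0 : ℤ) < (Lc : ℤ) := by exact_mod_cast hLc
  have hPk : (0 : ℤ) < ((Lc ^ k : ℕ) : ℤ) := by exact_mod_cast pow_pos (by omega) _
  have hF' : x' β % (Lc : ℤ) = (Lc : ℤ) - 1 := by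
    have e : ((Lc ^ (k + 1) : ℕ) : ℤ) = (Lc : ℤ) * ((Lc ^ k : ℕ) : ℤ) := by push_cast; ring
    rw [e] at hF
    exact ((emod_mul_eq_iff hLc0 hPk (x' β)).1 hF).1
  by_cases hβ : β = μ
  swap
  · exact absurd (symLinKerAt_eq_zero_of_exitFace_of_ne hLo hβ y hF') hq
  subst hβ
  -- the straight exit bond: the four coarse coordinates pair off
  obtain ⟨hxβ, htr⟩ := exitFace_support_mu hLo β y hq hF'
  have hc : ∀ i, 0 ≤ ctr (d + 1) Lc i ∧ ctr (d + 1) Lc i ≤ (Lc : ℤ) - 1 := by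
    intro i; rw [ctr_apply]; have := two_mul_half_add_one hLo; constructor <;> omega
  have hroot : ∀ i, ((Lc : ℤ) • y + ctr (d + 1) Lc) i / (Lc : ℤ) = y i := by
    intro i
    exact ediv_eq_of_mem_range hLc (by simp only [Pi.add_apply, Pi.smul_apply, smul_eq_mul]; constructor <;> nlinarith [(hc i).1, (hc i).2])
  have hroot' : ∀ i, ((Lc : ℤ) • y + ctr (d + 1) Lc + (Lc : ℤ) • unitVec β) i / (Lc : ℤ) = y i + (if i = β then 1 else 0) := by
    intro i
    refine ediv_eq_of_mem_range hLc ?_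
    simp only [Pi.add_apply, Pi.smul_apply, smul_eq_mul, unitVec_apply]
    split_ifs <;> constructor <;> nlinarith [(hc i).1, (hc i).2]
  have hlam : x' α / (Lc : ℤ) = y α := by
    by_cases hl : α = β
    · subst hl; exact ediv_eq_of_mem_range hLc ⟨by linarith, by linarith⟩
    · exact ediv_eq_of_mem_range hLc (htr α hl)
  have hlam' : (x' + unitVec β) α / (Lc : ℤ) = y α + (if α = β then 1 else 0) := by
    refine ediv_eq_of_mem_range hLc ?_
    simp only [Pi.add_apply, unitVec_apply]
    by_cases hl : α = β
    · subst hl; rw [if_pos rfl]; constructor <;> linarith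
    · rw [if_neg hl]; have := htr α hl; constructor <;> linarith
  -- all four `ψ`-values through the `Lc`-block labels
  have e1 : x' α / ((Lc ^ (k + 1) : ℕ) : ℤ) = y α / ((Lc ^ k : ℕ) : ℤ) := by rw [ediv_pow_succ_eq_blk Lc k x' α]; simp only [blk]; rw [hlam]
  have e2 : (x' + unitVec β) α / ((Lc ^ (k + 1) : ℕ) : ℤ) = (y α + (if α = β then 1 else 0)) / ((Lc ^ k : ℕ) : ℤ) := by
    rw [ediv_pow_succ_eq_blk Lc k (x' + unitVec β) α]; simp only [blk]; rw [hlam']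
  have e3 : ((Lc : ℤ) • y + ctr (d + 1) Lc) α / ((Lc ^ (k + 1) : ℕ) : ℤ) = y α / ((Lc ^ k : ℕ) : ℤ) := by
    rw [ediv_pow_succ_eq_blk Lc k _ α]; simp only [blk]; rw [hroot]
  have e4 : ((Lc : ℤ) • y + ctr (d + 1) Lc + (Lc : ℤ) • unitVec β) α / ((Lc ^ (k + 1) : ℕ) : ℤ) = (y α + (if α = β then 1 else 0)) / ((Lc ^ k : ℕ) : ℤ) := by
    rw [ediv_pow_succ_eq_blk Lc k _ α]; simp only [blk]; rw [hroot']
  rw [e1, e2, e3, e4]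
  ring

/-! ## §2 The first face leg through leaf-02's sym `dψ`-law; the second face leg kills every term; the three-face form -/

section Legs

variable [NeZero Lc]

/-- NOT IN PRINT; OUR BOOKKEEPING.  **THE FIRST FACE LEG OF THE Λ-PIECE** (any coefficient family `c`): leaf-02's `tsum_dz_mul_SLam_symHessFFAt` with `ψ = ⌊·_α ∕ Lc^{k+1}⌋`,
whose gradient is the exit-face form (`dz_coarseCoord`). -/
theorem tsum_face_mul_SLam_symHessFFAt (hLo : Odd Lc)
    (c : Fin (d + 1) → (Fin (d + 1) → ℤ) → Fin (d + 1) → (Fin (d + 1) → ℤ) → ℝ) (κ' : Fin (d + 1)) (u x' : Site (d + 1)) (α β : Fin (d + 1)) (k : ℕ) :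
    ∑' x : Site (d + 1), (if x α % ((Lc ^ (k + 1) : ℕ) : ℤ) = ((Lc ^ (k + 1) : ℕ) : ℤ) - 1 then (1 : ℝ) else 0) *
        SLam Lc c (fun μ y => symHessFFAt (ctr (d + 1) Lc) Lc μ y) κ' u x x' (Sum.inl α) (Sum.inl β)
      = -∑ μ, ∑' y, c μ y κ' u *
          (((((x') α / ((Lc ^ (k + 1) : ℕ) : ℤ) : ℤ) : ℝ) + (((x' + unitVec β) α / ((Lc ^ (k + 1) : ℕ) : ℤ) : ℤ) : ℝ) - ((((Lc : ℤ) • y + ctr (d + 1) Lc) α / ((Lc ^ (k + 1) : ℕ) : ℤ) : ℤ) : ℝ) - ((((Lc : ℤ) • y + ctr (d + 1) Lc + (Lc : ℤ) • unitVec μ) α / ((Lc ^ (k + 1) : ℕ) : ℤ) : ℤ) : ℝ)) * symLinKerAt (ctr (d + 1) Lc) Lc μ y (β, x') / 2) := by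
  have hLc : 1 ≤ Lc := by obtain ⟨m, rfl⟩ := hLo; omega
  have h := tsum_dz_mul_SLam_symHessFFAt (N := Lc) hLc (ctrOff_mem_box (d := d + 1) hLc) c κ' u x' β (fun z : Site (d + 1) => ((z α / ((Lc ^ (k + 1) : ℕ) : ℤ) : ℤ) : ℝ))
  beta_reduce at h
  simp only [show (toSite (ctrOff (d + 1) Lc) : Site (d + 1)) = ctr (d + 1) Lc from rfl] at h
  rw [← h]
  refine tsum_congr fun x => ?_
  rw [Finset.sum_eq_single α]
  · rw [dz_coarseCoord hLc k α α x, if_pos rfl, one_mul]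
  · intro κ _ hκ
    rw [dz_coarseCoord hLc k α κ x, if_neg hκ, zero_mul, zero_mul]
  · intro hα; exact absurd (Finset.mem_univ α) hα

/-- NOT IN PRINT; OUR BOOKKEEPING.  **THE SECOND FACE LEG KILLS EVERY TERM**: `[x′_β face] · Σ'_x [x_α face] · SΛ κ′ u x x′ (inl α) (inl β) = 0`
(`face_coordW_linKerAt_eq_zero` inside the `(μ, y)`-sums of `tsum_face_mul_SLam_symHessFFAt`). -/
theorem face_mul_tsum_face_mul_SLam_symHessFFAt (hLo : Odd Lc)
    (c : Fin (d + 1) → (Fin (d + 1) → ℤ) → Fin (d + 1) → (Fin (d + 1) → ℤ) → ℝ) (κ' : Fin (d + 1)) (u x' : Site (d + 1)) (α β : Fin (d + 1)) (k : ℕ) :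
    (if x' β % ((Lc ^ (k + 1) : ℕ) : ℤ) = ((Lc ^ (k + 1) : ℕ) : ℤ) - 1 then (1 : ℝ) else 0) *
      ∑' x : Site (d + 1), (if x α % ((Lc ^ (k + 1) : ℕ) : ℤ) = ((Lc ^ (k + 1) : ℕ) : ℤ) - 1 then (1 : ℝ) else 0) *
        SLam Lc c (fun μ y => symHessFFAt (ctr (d + 1) Lc) Lc μ y) κ' u x x' (Sum.inl α) (Sum.inl β) = 0 := by
  rw [tsum_face_mul_SLam_symHessFFAt hLo c κ' u x' α β k, mul_neg, neg_eq_zero, Finset.mul_sum]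
  refine Finset.sum_eq_zero fun μ _ => ?_
  rw [← tsum_mul_left]
  refine (tsum_congr fun y => ?_).trans tsum_zero
  have h0 := face_coordW_symLinKerAt_eq_zero hLo k μ y α β x'
  calc (if x' β % ((Lc ^ (k + 1) : ℕ) : ℤ) = ((Lc ^ (k + 1) : ℕ) : ℤ) - 1 then (1 : ℝ) else 0) * (c μ y κ' u *
          (((((x') α / ((Lc ^ (k + 1) : ℕ) : ℤ) : ℤ) : ℝ) + (((x' + unitVec β) α / ((Lc ^ (k + 1) : ℕ) : ℤ) : ℤ) : ℝ) - ((((Lc : ℤ) • y + ctr (d + 1) Lc) α / ((Lc ^ (k + 1) : ℕ) : ℤ) : ℤ) : ℝ) - ((((Lc : ℤ) • y + ctr (d + 1) Lc + (Lc : ℤ) • unitVec μ) α / ((Lc ^ (k + 1) : ℕ) : ℤ) : ℤ) : ℝ)) * symLinKerAt (ctr (d + 1) Lc) Lc μ y (β, x') / 2))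
      = c μ y κ' u / 2 * ((if x' β % ((Lc ^ (k + 1) : ℕ) : ℤ) = ((Lc ^ (k + 1) : ℕ) : ℤ) - 1 then (1 : ℝ) else 0) *
          (((((x') α / ((Lc ^ (k + 1) : ℕ) : ℤ) : ℤ) : ℝ) + (((x' + unitVec β) α / ((Lc ^ (k + 1) : ℕ) : ℤ) : ℤ) : ℝ) - ((((Lc : ℤ) • y + ctr (d + 1) Lc) α / ((Lc ^ (k + 1) : ℕ) : ℤ) : ℤ) : ℝ) - ((((Lc : ℤ) • y + ctr (d + 1) Lc + (Lc : ℤ) • unitVec μ) α / ((Lc ^ (k + 1) : ℕ) : ℤ) : ℤ) : ℝ)) * symLinKerAt (ctr (d + 1) Lc) Lc μ y (β, x'))) := by ring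
    _ = 0 := by rw [h0, mul_zero]

end Legs

/-! ## §4 The three-face-legs cell form of the Λ-piece vanishes (every slot; then summed over the slot face) -/

section ThreeFace

variable [NeZero Lc]

/-- NOT IN PRINT; OUR BOOKKEEPING.  **THE TWO-FACE-LEGS PAIR SUM OF THE Λ-PIECE VANISHES AT EVERY SLOT** (any coefficient family `c` making the Λ-piece a local
stencil family; every exit-face period `Lc^{k+1}`). -/
theorem tsum_faces_SLam_symHessFFAt_eq_zero (hLo : Odd Lc)
    {c : Fin (d + 1) → (Fin (d + 1) → ℤ) → Fin (d + 1) → (Fin (d + 1) → ℤ) → ℝ} {C δ : ℝ}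
    (hS : LocStencil (SLam Lc c (fun μ y => symHessFFAt (ctr (d + 1) Lc) Lc μ y)) C δ) (hδ : 0 < δ)
    (κ' : Fin (d + 1)) (u : Site (d + 1)) (α β : Fin (d + 1)) (k : ℕ) :
    ∑' yw : Site (d + 1) × Site (d + 1),
        (if yw.1 α % ((Lc ^ (k + 1) : ℕ) : ℤ) = ((Lc ^ (k + 1) : ℕ) : ℤ) - 1 then (1 : ℝ) else 0) *
          (if yw.2 β % ((Lc ^ (k + 1) : ℕ) : ℤ) = ((Lc ^ (k + 1) : ℕ) : ℤ) - 1 then (1 : ℝ) else 0) *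
          SLam Lc c (fun μ y => symHessFFAt (ctr (d + 1) Lc) Lc μ y) κ' u yw.1 yw.2 (Sum.inl α) (Sum.inl β) = 0 := by
  set SΛ := SLam Lc c (fun μ y => symHessFFAt (ctr (d + 1) Lc) Lc μ y) with hSΛ
  set Fα : Site (d + 1) → ℝ := fun x => if x α % ((Lc ^ (k + 1) : ℕ) : ℤ) = ((Lc ^ (k + 1) : ℕ) : ℤ) - 1 then 1 else 0 with hFα
  set Fβ : Site (d + 1) → ℝ := fun x => if x β % ((Lc ^ (k + 1) : ℕ) : ℤ) = ((Lc ^ (k + 1) : ℕ) : ℤ) - 1 then 1 else 0 with hFβ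
  -- summability of the swapped pair family `(w, y) ↦ Fα y · Fβ w · SΛ y w`
  have hsw : Summable fun wy : Site (d + 1) × Site (d + 1) => Fα wy.2 * Fβ wy.1 * SΛ κ' u wy.2 wy.1 (Sum.inl α) (Sum.inl β) := by
    have h := summable_weighted_pairs (hS κ' u) hδ (Sum.inl α) (Sum.inl β) (fun yw => Fα yw.1 * Fβ yw.2) (fun yw => by
      show |Fα yw.1 * Fβ yw.2| ≤ 1
      simp only [hFα, hFβ]; split_ifs <;> simp)
    have e : (fun wy : Site (d + 1) × Site (d + 1) => Fα wy.2 * Fβ wy.1 * SΛ κ' u wy.2 wy.1 (Sum.inl α) (Sum.inl β))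
        = (fun yw : Site (d + 1) × Site (d + 1) => Fα yw.1 * Fβ yw.2 * SΛ κ' u yw.1 yw.2 (Sum.inl α) (Sum.inl β)) ∘ (Equiv.prodComm _ _) := by
      funext wy; rfl
    rw [e]
    exact (Equiv.summable_iff _).2 h
  -- swap the legs and sum the first leg innermost
  have hswap : (∑' yw : Site (d + 1) × Site (d + 1), Fα yw.1 * Fβ yw.2 * SΛ κ' u yw.1 yw.2 (Sum.inl α) (Sum.inl β))
      = ∑' wy : Site (d + 1) × Site (d + 1), Fα wy.2 * Fβ wy.1 * SΛ κ' u wy.2 wy.1 (Sum.inl α) (Sum.inl β) := by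
    rw [← (Equiv.prodComm (Site (d + 1)) (Site (d + 1))).tsum_eq]
    rfl
  have hgoal : (∑' yw : Site (d + 1) × Site (d + 1), Fα yw.1 * Fβ yw.2 * SΛ κ' u yw.1 yw.2 (Sum.inl α) (Sum.inl β)) = 0 := by
    rw [hswap, hsw.tsum_prod]
    refine (tsum_congr fun w => ?_).trans tsum_zero
    have e1 : (∑' y : Site (d + 1), Fα y * Fβ w * SΛ κ' u y w (Sum.inl α) (Sum.inl β))
        = Fβ w * ∑' y : Site (d + 1), Fα y * SΛ κ' u y w (Sum.inl α) (Sum.inl β) := by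
      rw [← tsum_mul_left]
      refine tsum_congr fun y => ?_
      ring
    rw [e1]
    exact face_mul_tsum_face_mul_SLam_symHessFFAt hLo c κ' u w α β k
  simpa only [hFα, hFβ, hSΛ] using hgoal

/-- NOT IN PRINT; OUR BOOKKEEPING.  **THE THREE-FACE-LEGS CELL FORM OF THE Λ-PIECE VANISHES** (every slot face, every period `Lc^{k+1}`, any admissible `c`). -/
theorem threeFace_SLam_symHessFFAt_eq_zero (hLo : Odd Lc)
    {c : Fin (d + 1) → (Fin (d + 1) → ℤ) → Fin (d + 1) → (Fin (d + 1) → ℤ) → ℝ} {C δ : ℝ}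
    (hS : LocStencil (SLam Lc c (fun μ y => symHessFFAt (ctr (d + 1) Lc) Lc μ y)) C δ) (hδ : 0 < δ)
    (k : ℕ) (γ α β : Fin (d + 1)) :
    ∑ v ∈ box (d + 1) (Lc ^ (k + 1)), (if toSite v γ % ((Lc ^ (k + 1) : ℕ) : ℤ) = ((Lc ^ (k + 1) : ℕ) : ℤ) - 1 then (1 : ℝ) else 0) *
        ∑' yw : Site (d + 1) × Site (d + 1),
          (if yw.1 α % ((Lc ^ (k + 1) : ℕ) : ℤ) = ((Lc ^ (k + 1) : ℕ) : ℤ) - 1 then (1 : ℝ) else 0) *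
            (if yw.2 β % ((Lc ^ (k + 1) : ℕ) : ℤ) = ((Lc ^ (k + 1) : ℕ) : ℤ) - 1 then (1 : ℝ) else 0) *
            SLam Lc c (fun μ y => symHessFFAt (ctr (d + 1) Lc) Lc μ y) γ (toSite v) yw.1 yw.2 (Sum.inl α) (Sum.inl β) = 0 := by
  refine Finset.sum_eq_zero fun v _ => ?_
  rw [tsum_faces_SLam_symHessFFAt_eq_zero hLo hS hδ γ (toSite v) α β k, mul_zero]

end ThreeFace

/-! ## §3 The instances at an1's record: every level `j+1`, and level `0` -/

section Balaban

variable [NeZero Lc]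

/-- NOT IN PRINT; OUR BOOKKEEPING ([folklore]; **(T-H)_face AT THE COMB, EVERY LEVEL `j+1`**).  At an1's record (`(symTablesAn1S2 d Lc cΛt).H = symHessFFAt ρ_c Lc`, `Lc` odd): the
three-face-legs cell form (period `Lc^{k+1}`) of the Λ-piece `SLam Lc (lamCoeffK (KInvStep Lc (j+1)) (E2 d Lc (j+1)) Lc) symHessFFAt` vanishes. -/
theorem threeFace_SLam_lamCoeffK_sym_eq_zero (hLo : Odd Lc) (j k : ℕ) (γ α β : Fin (d + 1)) :
    ∑ v ∈ box (d + 1) (Lc ^ (k + 1)), (if toSite v γ % ((Lc ^ (k + 1) : ℕ) : ℤ) = ((Lc ^ (k + 1) : ℕ) : ℤ) - 1 then (1 : ℝ) else 0) *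
        ∑' yw : Site (d + 1) × Site (d + 1),
          (if yw.1 α % ((Lc ^ (k + 1) : ℕ) : ℤ) = ((Lc ^ (k + 1) : ℕ) : ℤ) - 1 then (1 : ℝ) else 0) *
            (if yw.2 β % ((Lc ^ (k + 1) : ℕ) : ℤ) = ((Lc ^ (k + 1) : ℕ) : ℤ) - 1 then (1 : ℝ) else 0) *
            SLam Lc (lamCoeffK (KInvStep (d := d) Lc (j + 1)) (E2 d Lc (j + 1)) Lc) (fun μ y => symHessFFAt (ctr (d + 1) Lc) Lc μ y)
              γ (toSite v) yw.1 yw.2 (Sum.inl α) (Sum.inl β) = 0 := by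
  have hLc : 1 ≤ Lc := by obtain ⟨m, rfl⟩ := hLo; omega
  obtain ⟨δA, CA, hδA, hCA, hA⟩ := decays_KInvStep (Lc := Lc) (d := d) (j + 1)
  obtain ⟨δE, CE, hδE, hCE, hE⟩ := decays_E2 (d := d) (Lc := Lc) (j + 1)
  set n : ℝ := min δA δE with hn
  have hn0 : 0 < n := lt_min hδA hδE
  have hA' : Decays (KInvStep (d := d) Lc (j + 1)) CA n := decays_mono hA hCA le_rfl (min_le_left _ _)
  have hE' : Decays (E2 d Lc (j + 1)) CE n := decays_mono hE hCE le_rfl (min_le_right _ _)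
  have hc := abs_lamCoeffK_le hA' hE' hn0 Lc
  have hn2 : (0 : ℝ) ≤ n / 2 := by positivity
  have hQ : VertexFamily (fun μ y => symHessFFAt (ctr (d + 1) Lc) Lc μ y) Lc
      (2 * (ell (d + 1) Lc : ℝ) ^ 2 * Real.exp (4 * ((d : ℝ) + 1) * Lc * (n / 2))) (n / 2) :=
    vertexFamily_symHessFFAt (d := d) hLc (ctrOff_mem_box (d := d + 1) hLc) hn2
  have h3 := locStencil_SLam (N := Lc) hc hQ (by positivity)
    (mul_nonneg (mul_nonneg (Nat.cast_nonneg _) (mul_nonneg hCA hCE)) (Zl_nonneg (by linarith)))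
  exact threeFace_SLam_symHessFFAt_eq_zero hLo h3 (by positivity) k γ α β

/-- NOT IN PRINT; OUR BOOKKEEPING ([folklore]; **(T-H)_face AT THE COMB, LEVEL `0`**).  The three-face-legs cell form of the Λ₀-piece `SLam Lc (lamCoeffOf (KInv Lc) Lc) symHessFFAt` of
`S0NOf` at an1's record vanishes. -/
theorem threeFace_SLam_lamCoeffOf_sym_eq_zero (hLo : Odd Lc) (k : ℕ) (γ α β : Fin (d + 1)) :
    ∑ v ∈ box (d + 1) (Lc ^ (k + 1)), (if toSite v γ % ((Lc ^ (k + 1) : ℕ) : ℤ) = ((Lc ^ (k + 1) : ℕ) : ℤ) - 1 then (1 : ℝ) else 0) *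
        ∑' yw : Site (d + 1) × Site (d + 1),
          (if yw.1 α % ((Lc ^ (k + 1) : ℕ) : ℤ) = ((Lc ^ (k + 1) : ℕ) : ℤ) - 1 then (1 : ℝ) else 0) *
            (if yw.2 β % ((Lc ^ (k + 1) : ℕ) : ℤ) = ((Lc ^ (k + 1) : ℕ) : ℤ) - 1 then (1 : ℝ) else 0) *
            SLam Lc (lamCoeffOf (KInv (N := Lc) (d := d)) Lc) (fun μ y => symHessFFAt (ctr (d + 1) Lc) Lc μ y)
              γ (toSite v) yw.1 yw.2 (Sum.inl α) (Sum.inl β) = 0 := by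
  have hLc : 1 ≤ Lc := by obtain ⟨m, rfl⟩ := hLo; omega
  obtain ⟨δ₀, C, hδ₀, hC, hdec⟩ := decays_KInv (N := Lc) (d := d)
  have hc := abs_lamCoeffOf_le (N := Lc) hdec hC hδ₀.le
  have hQ : VertexFamily (fun μ y => symHessFFAt (ctr (d + 1) Lc) Lc μ y) Lc
      (2 * (ell (d + 1) Lc : ℝ) ^ 2 * Real.exp (4 * ((d : ℝ) + 1) * Lc * δ₀)) δ₀ :=
    vertexFamily_symHessFFAt (d := d) hLc (ctrOff_mem_box (d := d + 1) hLc) hδ₀.le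
  have h3 := locStencil_SLam (N := Lc) hc hQ hδ₀ (mul_nonneg (mul_nonneg (by positivity) hC) (Real.exp_pos _).le)
  exact threeFace_SLam_symHessFFAt_eq_zero hLo h3 (by positivity) k γ α β

end Balaban

end Summit.QuantumFields.BalabanUV.Beta.GAN24.SymLambdaPieceThreeFace

end
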